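import Summits.CriticalPhenomena.PercolationContinuityZ3.Theorems.Transplant.SkelPhiSeedSlab
import Summits.CriticalPhenomena.PercolationContinuityZ3.Theorems.Transplant.SkelPhiQStepsN
import HarnessLib

/-!
# N1 (the `{±1}` node), LEVEL 1, kit adapter file N-K2′: THE DEEP SEED SLAB GEOMETRY OF A WINDOW LEVEL UNDER QUASI-STEPS OF COST `N` — the inward quasi-step,
# the tangential quasi-path with its link sets, and the deep slab centre, for a bare planar map `ψ : V → ℤ²` with `Skelφ.QStepsN G ψ N`
# (`SkelPhiSeedSlab` §2, §4 — p1 gen 9, D″ — with `hstep : Steps G ψ ↦ hq : QStepsN G ψ N`; the N-generic twin of `SkelPhiSeedSlabN`, N = 3)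

builds on p205010 (kernel theorem, internal audit signed; external expert review pending) — nothing in this file uses p205010; nothing here is a
claim about the open node `SamePDropOfSkeletonNeg`.
Lane `prim-bschramm`, seat `prim-bschramm-p1` (gen 11; kit-layer port per design-owner ruling 2026-08-21 13:19:49Z (2)); helper file
(`--supports stmt-CriticalPhenomena-4575 --as helper`).
The contact data `Skelφ.inNbr` (SkelPhiSeedKit) and `Skelφ.exitDir` / `exists_coord_eq_of_contact` / `exitDir_spec` (SkelPhiSeedSlab §3) use `Lip`
only and are REUSED; the planar gadgets `SkelI.slabPt/tanOff/tanTgt/tanSign/deepPt` and `Skelφ.pathLen` are map-only and REUSED.  What changes: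
every unit step of the window map is a `Link3` (`SkelPhiQStepsReach`: `qstep`, `walkN`, `linkFin`, `colPtN`), so graph radii triple and the path's
vertex set `pathFinQ` carries the links' inner vertices; every FOOTPRINT statement (`ψ` of the inward vertex, of the path points, of the deep
centre) is verbatim the D″ one.
* §1 `inwardQ` + `inwardQ_spec` (twin of `inward_spec`: `v` itself or LINKED to `v`; exit coordinate clamped into `[Lo+1, Hi−1]`, other unchanged);
* §2 **`pathPtQ`** (`= walkN i₁ s (inwardQ y) k`), `ψ_pathPtQ`, `ψ_pathPtQ_last`, `pathPtQ_link`, `pathPtQ_mem_graphBall` (`B_G(y, 3(k+1))`);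
  **`pathFinQ`** (`linkFin y p₀ ∪ ⋃_{k<K} linkFin p_k p_{k+1}`), `inNbr_mem_pathFinQ`-type membership lemmas `left_mem_pathFinQ`, `pathPtQ_mem_pathFinQ`,
  `ψ_of_mem_pathFinQ` (footprint: `ψ v = ψ y` or `ψ v = ψ p_k`, `k ≤ K`), `pathFinQ_subset_graphBall` (`B_G(y, 3K+6)`), `card_pathFinQ_le` (`≤ 4(K+1)`),
  `pathIn_of_pathFinQ_subset` (joined to `y` inside any `A ⊇ pathFinQ`);
* §3 **`deepCtrQ`** (`= colPtQ y deepPt`), `deepCtrQ_spec` (`B_G(y, 3(ℓs+1+T₀))`, `ψ deepCtrQ = deepPt`), `ψ_deepCtrQ_exit`, `ψ_deepCtrQ_tan`.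
[cite: KozmaNitzan2024, §4 Lemma 10, p. 19 (Step III: x = y + e_i), p. 21 (v(P) + Λ_M, the shift of v(P) along the face), p. 26 ((29))]
[cite: MartineauTassion2017, §4.3]
-/

open scoped Classical

namespace Summit.CriticalPhenomena.PercolationContinuityZ3.Theorems.Transplant

namespace Skelφ

open Literature.Probability.Percolation Literature.Probability.LatticeModels SimpleGraph KNLevels
open Literature.Probability.Percolation.KozmaNitzan.Cells (oth oth_ne eq_oth_of_ne oth_oth)
open Literature.Barriers.CriticalPhenomena (graphBall graphBall_finite mem_graphBall_self graphBall_mono)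
open SkelI (slabPt tanOff tanTgt tanTgt_mem natAbs_tanTgt_sub_le tanSign natAbs_mul_tanSign deepPt)

variable {V : Type} (G : SimpleGraph V) (ψ : V → Site 2)

noncomputable section

/-! ## §1 The inward quasi-step off the boundary layer of a planar box -/

/-- **One inward quasi-step in coordinate `i`** off the boundary layer of the box `Icc Lo Hi`: from the face `ψ v i = Lo i` (resp. `Hi i`) one
chosen quasi-step with `ψ` moved by `+e_i` (resp. `−e_i`); elsewhere `v` itself.  Twin of `Skelφ.inward`. [cite: KozmaNitzan2024, §4 p. 21 (v(P))] -/
def inwardQ (N : ℕ) (Lo Hi : Site 2) (i : Fin 2) (v : V) : V :=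
  if ψ v i = Lo i then qstepQ G ψ N i 1 v else if ψ v i = Hi i then qstepQ G ψ N i (-1) v else v

variable {G ψ}

/-- Specification of the inward quasi-step (box side `≥ 2` in coordinate `i`, `ψ v` in the box; under `QSteps`): it is `v` or LINKED to `v`,
and its planar coordinate is `ψ v` with the `i`-th entry clamped into `[Lo i + 1, Hi i − 1]`, the other entry unchanged. [folklore] -/
theorem inwardQ_spec {N : ℕ} (hq : QStepsN G ψ N) {Lo Hi : Site 2} (i : Fin 2) (hw : Lo i + 2 ≤ Hi i) {v : V} (hv : ψ v ∈ Finset.Icc Lo Hi) :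
    (inwardQ G ψ N Lo Hi i v = v ∨ LinkN G ψ N v (inwardQ G ψ N Lo Hi i v)) ∧
      ψ (inwardQ G ψ N Lo Hi i v) i = slabPt Lo Hi 1 (ψ v) i ∧ ∀ k, k ≠ i → ψ (inwardQ G ψ N Lo Hi i v) k = ψ v k := by
  rw [Finset.mem_Icc] at hv
  have h1 : Lo i ≤ ψ v i := hv.1 i
  have h2 : ψ v i ≤ Hi i := hv.2 i
  unfold inwardQ
  by_cases hlo : ψ v i = Lo i
  · rw [if_pos hlo]
    obtain ⟨hψ, hlink⟩ := qstepQ_spec hq i 1 v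
    refine ⟨Or.inr hlink, ?_, fun k hk => ?_⟩
    · rw [hψ]; simp only [Pi.add_apply, Pi.single_eq_same, Units.val_one, slabPt, max_def, min_def, Nat.cast_one]
      split_ifs <;> omega
    · rw [hψ]; simp [Pi.single_eq_of_ne hk]
  · rw [if_neg hlo]
    by_cases hhi : ψ v i = Hi i
    · rw [if_pos hhi]
      obtain ⟨hψ, hlink⟩ := qstepQ_spec hq i (-1) v
      refine ⟨Or.inr hlink, ?_, fun k hk => ?_⟩
      · rw [hψ]; simp only [Pi.add_apply, Pi.single_eq_same, Units.val_neg, Units.val_one, slabPt, max_def, min_def, Nat.cast_one]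
        split_ifs <;> omega
      · rw [hψ]; simp [Pi.single_eq_of_ne hk]
    · rw [if_neg hhi]
      refine ⟨Or.inl rfl, ?_, fun k _ => rfl⟩
      simp only [slabPt, max_def, min_def, Nat.cast_one]
      split_ifs <;> omega

/-- The inward vertex lies in `B_G(v, 3)` (under the hypotheses of `inwardQ_spec`). [folklore] -/
theorem inwardQ_mem_graphBall {N : ℕ} (hq : QStepsN G ψ N) {Lo Hi : Site 2} (i : Fin 2) (hw : Lo i + 2 ≤ Hi i) {v : V} (hv : ψ v ∈ Finset.Icc Lo Hi) :
    inwardQ G ψ N Lo Hi i v ∈ graphBall G v N := by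
  rcases (inwardQ_spec hq i hw hv).1 with h | h
  · rw [h]; exact mem_graphBall_self G v N
  · exact h.mem_graphBall

/-! ## §2 The tangential quasi-path of a contact and its link sets -/

variable (G ψ) in
/-- **The near region's quasi-path** of a contact with inner neighbour `y` and exit coordinate `i₀`: `p_k = walkN i₁ s (inwardQ y) k` with
`i₁ = oth i₀`, `s` the sign of `τ − ψ y i₁`, `τ` the tangential target at depth `T₀ = tanOff ℓs M`.  Twin of `Skelφ.pathPt`. [cite: KozmaNitzan2024, §4 p. 21] -/
def pathPtQ (N : ℕ) (Lo Hi : Site 2) (ℓs M : ℕ) (i₀ : Fin 2) (y : V) (k : ℕ) : V :=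
  walkQ G ψ N (oth i₀) (tanSign (tanTgt Lo Hi ℓs M (oth i₀) (ψ y) - ψ y (oth i₀))) (inwardQ G ψ N Lo Hi i₀ y) k

/-- Coordinates along the quasi-path: exit coordinate `ψ y i₀ ∓ 1` (one step off the face), tangential coordinate `ψ y i₁ + k s`. [folklore] -/
theorem ψ_pathPtQ {N : ℕ} (hq : QStepsN G ψ N) {Lo Hi : Site 2} {ℓs M : ℕ} (i₀ : Fin 2) (hw2 : Lo i₀ + 2 ≤ Hi i₀) {y : V} (hy : ψ y ∈ Finset.Icc Lo Hi)
    (k : ℕ) :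
    ψ (pathPtQ G ψ N Lo Hi ℓs M i₀ y k) i₀ = slabPt Lo Hi 1 (ψ y) i₀ ∧
      ψ (pathPtQ G ψ N Lo Hi ℓs M i₀ y k) (oth i₀) =
        ψ y (oth i₀) + (k : ℤ) * (tanSign (tanTgt Lo Hi ℓs M (oth i₀) (ψ y) - ψ y (oth i₀)) : ℤ) := by
  obtain ⟨-, h1, h2⟩ := inwardQ_spec hq i₀ hw2 hy
  unfold pathPtQ
  rw [F_walkQ hq]
  refine ⟨?_, ?_⟩
  · rw [Pi.add_apply, Pi.single_eq_of_ne (oth_ne i₀).symm, add_zero, h1]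
  · rw [Pi.add_apply, Pi.single_eq_same, h2 _ (oth_ne i₀)]

/-- The whole planar position of a path point. [folklore] -/
theorem ψ_pathPtQ_eq {N : ℕ} (hq : QStepsN G ψ N) (Lo Hi : Site 2) (ℓs M : ℕ) (i₀ : Fin 2) (y : V) (k : ℕ) :
    ψ (pathPtQ G ψ N Lo Hi ℓs M i₀ y k) =
      ψ (inwardQ G ψ N Lo Hi i₀ y) + Pi.single (oth i₀) ((k : ℤ) * (tanSign (tanTgt Lo Hi ℓs M (oth i₀) (ψ y) - ψ y (oth i₀)) : ℤ)) := by
  unfold pathPtQ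
  rw [F_walkQ hq]

/-- The last path vertex sits over `(ψ y i₀ ∓ 1, τ)`. [folklore] -/
theorem ψ_pathPtQ_last {N : ℕ} (hq : QStepsN G ψ N) {Lo Hi : Site 2} {ℓs M : ℕ} (i₀ : Fin 2) (hw2 : Lo i₀ + 2 ≤ Hi i₀) {y : V}
    (hy : ψ y ∈ Finset.Icc Lo Hi) :
    ψ (pathPtQ G ψ N Lo Hi ℓs M i₀ y (pathLen ψ Lo Hi ℓs M i₀ y)) (oth i₀) = tanTgt Lo Hi ℓs M (oth i₀) (ψ y) := by
  rw [(ψ_pathPtQ hq i₀ hw2 hy _).2, pathLen, natAbs_mul_tanSign]; ring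

/-- Consecutive path vertices are linked; `p₀ = inwardQ y`. [folklore] -/
theorem pathPtQ_link {N : ℕ} (hq : QStepsN G ψ N) (Lo Hi : Site 2) (ℓs M : ℕ) (i₀ : Fin 2) (y : V) (k : ℕ) :
    LinkN G ψ N (pathPtQ G ψ N Lo Hi ℓs M i₀ y k) (pathPtQ G ψ N Lo Hi ℓs M i₀ y (k + 1)) :=
  walkQ_link hq _ _ _ k

/-- `p₀ = inwardQ y`. [folklore] -/
@[simp] theorem pathPtQ_zero (N : ℕ) (Lo Hi : Site 2) (ℓs M : ℕ) (i₀ : Fin 2) (y : V) : pathPtQ G ψ N Lo Hi ℓs M i₀ y 0 = inwardQ G ψ N Lo Hi i₀ y := rfl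

/-- Path vertices are within graph distance `3(k + 1)` of `y`. [folklore] -/
theorem pathPtQ_mem_graphBall {N : ℕ} (hq : QStepsN G ψ N) {Lo Hi : Site 2} {ℓs M : ℕ} (i₀ : Fin 2) (hw2 : Lo i₀ + 2 ≤ Hi i₀) {y : V}
    (hy : ψ y ∈ Finset.Icc Lo Hi) (k : ℕ) : pathPtQ G ψ N Lo Hi ℓs M i₀ y k ∈ graphBall G y (N * (k + 1)) := by
  have h := BoxProdZ2.mem_graphBall_add G (inwardQ_mem_graphBall hq i₀ hw2 hy) (walkQ_mem_graphBall hq (oth i₀)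
    (tanSign (tanTgt Lo Hi ℓs M (oth i₀) (ψ y) - ψ y (oth i₀))) (inwardQ G ψ N Lo Hi i₀ y) k)
  unfold pathPtQ
  exact graphBall_mono G y (by rw [Nat.mul_succ, Nat.add_comm]) h

section PathFin

variable [DecidableEq V]

variable (G ψ) in
/-- **The vertex set of the quasi-path** `{y} ∪ link(y, p₀) ∪ ⋃_{k < K} link(p_k, p_{k+1})` (`K = pathLen`): the path points AND the inner vertices
of their links (so that it is `G`-connected), all with the planar footprint of `y` or of a path point.  Twin of `Skelφ.pathFin`. [this work] -/
def pathFinQ (N : ℕ) (Lo Hi : Site 2) (ℓs M : ℕ) (i₀ : Fin 2) (y : V) : Finset V :=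
  linkFinQ G ψ N y (inwardQ G ψ N Lo Hi i₀ y) ∪
    (Finset.range (pathLen ψ Lo Hi ℓs M i₀ y)).biUnion
      (fun k => linkFinQ G ψ N (pathPtQ G ψ N Lo Hi ℓs M i₀ y k) (pathPtQ G ψ N Lo Hi ℓs M i₀ y (k + 1)))

/-- The inner neighbour belongs to the path's vertex set. [folklore] -/
theorem left_mem_pathFinQ (N : ℕ) (Lo Hi : Site 2) (ℓs M : ℕ) (i₀ : Fin 2) (y : V) : y ∈ pathFinQ G ψ N Lo Hi ℓs M i₀ y := by
  unfold pathFinQ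
  exact Finset.mem_union_left _ (left_mem_linkFinQ _ _ _)

/-- Every path point `p_k`, `k ≤ K`, belongs to the path's vertex set (under `QSteps`, box side `≥ 2`, `ψ y` in the box). [folklore] -/
theorem pathPtQ_mem_pathFinQ {N : ℕ} (hq : QStepsN G ψ N) {Lo Hi : Site 2} {ℓs M : ℕ} (i₀ : Fin 2) (hw2 : Lo i₀ + 2 ≤ Hi i₀) {y : V}
    (hy : ψ y ∈ Finset.Icc Lo Hi) {k : ℕ} (hk : k ≤ pathLen ψ Lo Hi ℓs M i₀ y) :
    pathPtQ G ψ N Lo Hi ℓs M i₀ y k ∈ pathFinQ G ψ N Lo Hi ℓs M i₀ y := by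
  unfold pathFinQ
  rcases Nat.eq_zero_or_pos k with rfl | hk0
  · refine Finset.mem_union_left _ ?_
    rw [pathPtQ_zero]
    rcases (inwardQ_spec hq i₀ hw2 hy).1 with h | h
    · rw [h]; exact left_mem_linkFinQ _ _ _
    · exact right_mem_linkFinQ h
  · refine Finset.mem_union_right _ (Finset.mem_biUnion.2 ⟨k - 1, Finset.mem_range.2 (by omega), ?_⟩)
    have e : k - 1 + 1 = k := by omega
    rw [e]
    exact right_mem_linkFinQ (by have := pathPtQ_link hq Lo Hi ℓs M i₀ y (k - 1); rwa [e] at this)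

/-- **Footprint of the path's vertex set**: every vertex is at `ψ y` or at `ψ p_k` for some `k ≤ K`. [folklore] -/
theorem ψ_of_mem_pathFinQ {N : ℕ} {Lo Hi : Site 2} {ℓs M : ℕ} {i₀ : Fin 2} {y v : V} (hv : v ∈ pathFinQ G ψ N Lo Hi ℓs M i₀ y) :
    ψ v = ψ y ∨ ∃ k, k ≤ pathLen ψ Lo Hi ℓs M i₀ y ∧ ψ v = ψ (pathPtQ G ψ N Lo Hi ℓs M i₀ y k) := by
  unfold pathFinQ at hv
  rcases Finset.mem_union.1 hv with h | h
  · rcases F_of_mem_linkFinQ' h with h' | h'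
    · exact Or.inl h'
    · exact Or.inr ⟨0, Nat.zero_le _, by rw [h', pathPtQ_zero]⟩
  · obtain ⟨k, hk, hu⟩ := Finset.mem_biUnion.1 h
    rw [Finset.mem_range] at hk
    rcases F_of_mem_linkFinQ' hu with h' | h'
    · exact Or.inr ⟨k, hk.le, h'⟩
    · exact Or.inr ⟨k + 1, hk, by rw [h']⟩

/-- The path's vertex set lies in `B_G(y, 3K + 6)` (under `QSteps`, box side `≥ 2`, `ψ y` in the box). [folklore] -/
theorem pathFinQ_subset_graphBall {N : ℕ} (hq : QStepsN G ψ N) {Lo Hi : Site 2} {ℓs M : ℕ} (i₀ : Fin 2) (hw2 : Lo i₀ + 2 ≤ Hi i₀) {y : V}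
    (hy : ψ y ∈ Finset.Icc Lo Hi) :
    ∀ v ∈ pathFinQ G ψ N Lo Hi ℓs M i₀ y, v ∈ graphBall G y (N * pathLen ψ Lo Hi ℓs M i₀ y + 2 * N) := by
  intro v hv
  unfold pathFinQ at hv
  rcases Finset.mem_union.1 hv with h | h
  · exact graphBall_mono G y (by omega) (linkFinQ_subset_graphBall _ _ _ v h)
  · obtain ⟨k, hk, hu⟩ := Finset.mem_biUnion.1 h
    rw [Finset.mem_range] at hk
    have h1 := BoxProdZ2.mem_graphBall_add G (pathPtQ_mem_graphBall hq (ℓs := ℓs) (M := M) i₀ hw2 hy k) (linkFinQ_subset_graphBall _ _ _ v hu)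
    exact graphBall_mono G y (by
      have hk' : N * (k + 1) + N ≤ N * pathLen ψ Lo Hi ℓs M i₀ y + 2 * N := by
        have := Nat.mul_le_mul_left N (show k + 1 ≤ pathLen ψ Lo Hi ℓs M i₀ y from hk)
        omega
      exact hk') h1

/-- The path's vertex set has at most `4(K + 1)` vertices. [folklore] -/
theorem card_pathFinQ_le (N : ℕ) (Lo Hi : Site 2) (ℓs M : ℕ) (i₀ : Fin 2) (y : V) :
    (pathFinQ G ψ N Lo Hi ℓs M i₀ y).card ≤ (N + 1) * (pathLen ψ Lo Hi ℓs M i₀ y + 1) := by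
  unfold pathFinQ
  refine (Finset.card_union_le _ _).trans ?_
  have h2 : ((Finset.range (pathLen ψ Lo Hi ℓs M i₀ y)).biUnion
      (fun k => linkFinQ G ψ N (pathPtQ G ψ N Lo Hi ℓs M i₀ y k) (pathPtQ G ψ N Lo Hi ℓs M i₀ y (k + 1)))).card ≤
      (N + 1) * pathLen ψ Lo Hi ℓs M i₀ y := by
    refine Finset.card_biUnion_le.trans ?_
    calc ∑ k ∈ Finset.range (pathLen ψ Lo Hi ℓs M i₀ y), (linkFinQ G ψ N (pathPtQ G ψ N Lo Hi ℓs M i₀ y k) (pathPtQ G ψ N Lo Hi ℓs M i₀ y (k + 1))).card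
        ≤ ∑ _k ∈ Finset.range (pathLen ψ Lo Hi ℓs M i₀ y), (N + 1) := Finset.sum_le_sum fun k _ => card_linkFinQ_le _ _ _
      _ = (N + 1) * pathLen ψ Lo Hi ℓs M i₀ y := by rw [Finset.sum_const, Finset.card_range, smul_eq_mul, mul_comm]
  have h1' : (linkFinQ G ψ N y (inwardQ G ψ N Lo Hi i₀ y)).card ≤ N + 1 := card_linkFinQ_le _ _ _
  nlinarith

/-- **The path's vertex set is `G`-connected from `y` inside any set containing it** (under `QSteps`, box side `≥ 2`, `ψ y` in the box).
[folklore] -/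
theorem pathIn_of_pathFinQ_subset {N : ℕ} (hq : QStepsN G ψ N) {Lo Hi : Site 2} {ℓs M : ℕ} (i₀ : Fin 2) (hw2 : Lo i₀ + 2 ≤ Hi i₀) {y : V}
    (hy : ψ y ∈ Finset.Icc Lo Hi) {A : Set V} (hA : ∀ v ∈ pathFinQ G ψ N Lo Hi ℓs M i₀ y, v ∈ A) :
    ∀ v ∈ pathFinQ G ψ N Lo Hi ℓs M i₀ y, PathIn G A y v := by
  -- every path point is reached inside `A`
  have hlink0 : ∀ u ∈ linkFinQ G ψ N y (inwardQ G ψ N Lo Hi i₀ y), u ∈ A := fun u hu => hA u (by unfold pathFinQ; exact Finset.mem_union_left _ hu)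
  have hlinkk : ∀ k, k < pathLen ψ Lo Hi ℓs M i₀ y →
      ∀ u ∈ linkFinQ G ψ N (pathPtQ G ψ N Lo Hi ℓs M i₀ y k) (pathPtQ G ψ N Lo Hi ℓs M i₀ y (k + 1)), u ∈ A := fun k hk u hu =>
    hA u (by unfold pathFinQ; exact Finset.mem_union_right _ (Finset.mem_biUnion.2 ⟨k, Finset.mem_range.2 hk, hu⟩))
  have hP : ∀ k, k ≤ pathLen ψ Lo Hi ℓs M i₀ y → PathIn G A y (pathPtQ G ψ N Lo Hi ℓs M i₀ y k) := by
    intro k hk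
    induction k with
    | zero =>
      rw [pathPtQ_zero]
      rcases (inwardQ_spec hq i₀ hw2 hy).1 with h | h
      · rw [h]; exact PathIn.refl (hlink0 _ (left_mem_linkFinQ _ _ _))
      · exact pathIn_of_linkFinQ_subset hlink0 _ (right_mem_linkFinQ h)
    | succ k ih =>
      exact (ih (by omega)).trans
        (pathIn_of_linkFinQ_subset (hlinkk k (by omega)) _ (right_mem_linkFinQ (pathPtQ_link hq Lo Hi ℓs M i₀ y k)))
  intro v hv
  unfold pathFinQ at hv
  rcases Finset.mem_union.1 hv with h | h
  · exact pathIn_of_linkFinQ_subset hlink0 v h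
  · obtain ⟨k, hk, hu⟩ := Finset.mem_biUnion.1 h
    rw [Finset.mem_range] at hk
    exact (hP k hk.le).trans (pathIn_of_linkFinQ_subset (hlinkk k hk) v hu)

end PathFin

/-! ## §3 The deep slab centre of a contact -/

variable (G ψ) in
/-- **The deep slab centre** of a contact `x`: the column vertex (by quasi-steps), seen from the inner neighbour `y`, over `deepPt` (exit coordinate
`ψ y i₀ − σ(ℓs+1)`, tangential coordinate `τ`).  Twin of `Skelφ.deepCtr`. [cite: KozmaNitzan2024, §4 p. 21 (v(P))] -/
def deepCtrQ (N : ℕ) (w₀ : V) (R : ℕ) (Lo Hi : Site 2) (ℓs M : ℕ) (x : V) : V :=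
  colPtQ G ψ N (inNbr G ψ w₀ R (Finset.Icc Lo Hi) x)
    (deepPt Lo Hi ℓs M (exitDir G ψ w₀ R Lo Hi x) (ψ (inNbr G ψ w₀ R (Finset.Icc Lo Hi) x)))

/-- Specification of the deep centre (under `QSteps`; box sides `≥ 2T₀`, `ψ y` in the box): within graph distance `3(ℓs + 1 + T₀)` of `y` and
`ψ (deepCtrQ) = deepPt`. [folklore] -/
theorem deepCtrQ_spec {N : ℕ} (hq : QStepsN G ψ N) {w₀ : V} {R : ℕ} {Lo Hi : Site 2} {ℓs M : ℕ} (hw : ∀ i, Lo i + 2 * tanOff ℓs M ≤ Hi i) {x : V}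
    (hy : ψ (inNbr G ψ w₀ R (Finset.Icc Lo Hi) x) ∈ Finset.Icc Lo Hi) :
    deepCtrQ G ψ N w₀ R Lo Hi ℓs M x ∈ graphBall G (inNbr G ψ w₀ R (Finset.Icc Lo Hi) x) (N * (ℓs + 1 + tanOff ℓs M)) ∧
      ψ (deepCtrQ G ψ N w₀ R Lo Hi ℓs M x) =
        deepPt Lo Hi ℓs M (exitDir G ψ w₀ R Lo Hi x) (ψ (inNbr G ψ w₀ R (Finset.Icc Lo Hi) x)) := by
  set y := inNbr G ψ w₀ R (Finset.Icc Lo Hi) x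
  have h := colPtQ_spec hq y (deepPt Lo Hi ℓs M (exitDir G ψ w₀ R Lo Hi x) (ψ y))
  refine ⟨graphBall_mono G y ?_ h.1, h.2⟩
  refine Nat.mul_le_mul_left N ?_
  rw [Finset.mem_Icc] at hy
  -- per-coordinate distances: `ℓs + 1` in the exit coordinate, `≤ T₀` in the other
  have hc : ∀ i, (deepPt Lo Hi ℓs M (exitDir G ψ w₀ R Lo Hi x) (ψ y) i - ψ y i).natAbs ≤
      if i = (exitDir G ψ w₀ R Lo Hi x).1 then ℓs + 1 else tanOff ℓs M := by
    intro i
    by_cases hi0 : i = (exitDir G ψ w₀ R Lo Hi x).1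
    · rw [if_pos hi0]; simp only [deepPt, if_pos hi0]
      rcases Int.units_eq_one_or (exitDir G ψ w₀ R Lo Hi x).2 with h1 | h1 <;> rw [h1] <;> push_cast <;> omega
    · rw [if_neg hi0]; simp only [deepPt, if_neg hi0]
      exact natAbs_tanTgt_sub_le i (hw i) (hy.1 i) (hy.2 i)
  have h0 := hc 0; have h1 := hc 1
  have hne : (0 : Fin 2) ≠ 1 := by decide
  by_cases he : (exitDir G ψ w₀ R Lo Hi x).1 = 0
  · rw [he] at h0 h1; rw [if_pos rfl] at h0; rw [if_neg hne.symm] at h1; omega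
  · have he1 : (exitDir G ψ w₀ R Lo Hi x).1 = 1 := by
      rcases Fin.eq_zero_or_eq_succ ((exitDir G ψ w₀ R Lo Hi x).1) with h | ⟨k, hk⟩
      · exact absurd h he
      · rw [hk]; exact congrArg Fin.succ (Fin.eq_zero k)
    rw [he1] at h0 h1; rw [if_neg hne] at h0; rw [if_pos rfl] at h1; omega

/-- The exit coordinate of the deep centre: `ψ t i₀ = ψ y i₀ − σ (ℓs + 1)`. [folklore] -/
theorem ψ_deepCtrQ_exit {N : ℕ} (hq : QStepsN G ψ N) {w₀ : V} {R : ℕ} {Lo Hi : Site 2} {ℓs M : ℕ} (hw : ∀ i, Lo i + 2 * tanOff ℓs M ≤ Hi i) {x : V}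
    (hy : ψ (inNbr G ψ w₀ R (Finset.Icc Lo Hi) x) ∈ Finset.Icc Lo Hi) :
    ψ (deepCtrQ G ψ N w₀ R Lo Hi ℓs M x) (exitDir G ψ w₀ R Lo Hi x).1 =
      ψ (inNbr G ψ w₀ R (Finset.Icc Lo Hi) x) (exitDir G ψ w₀ R Lo Hi x).1 - ((exitDir G ψ w₀ R Lo Hi x).2 : ℤ) * (ℓs + 1) := by
  rw [(deepCtrQ_spec hq hw hy).2]; simp [deepPt]

/-- The tangential coordinate of the deep centre is the tangential target, at depth `≥ T₀`. [folklore] -/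
theorem ψ_deepCtrQ_tan {N : ℕ} (hq : QStepsN G ψ N) {w₀ : V} {R : ℕ} {Lo Hi : Site 2} {ℓs M : ℕ} (hw : ∀ i, Lo i + 2 * tanOff ℓs M ≤ Hi i) {x : V}
    (hy : ψ (inNbr G ψ w₀ R (Finset.Icc Lo Hi) x) ∈ Finset.Icc Lo Hi) :
    ψ (deepCtrQ G ψ N w₀ R Lo Hi ℓs M x) (oth (exitDir G ψ w₀ R Lo Hi x).1) =
      tanTgt Lo Hi ℓs M (oth (exitDir G ψ w₀ R Lo Hi x).1) (ψ (inNbr G ψ w₀ R (Finset.Icc Lo Hi) x)) := by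
  rw [(deepCtrQ_spec hq hw hy).2]; simp [deepPt, oth_ne]

end

end Skelφ

end Summit.CriticalPhenomena.PercolationContinuityZ3.Theorems.Transplant
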